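import Mathlib.LinearAlgebra.Determinant
import Mathlib.LinearAlgebra.Multilinear.Basis
import Mathlib.Algebra.CharP.Frobenius
import Mathlib.Algebra.CharP.Reduced
import Mathlib.FieldTheory.Perfect
import Mathlib.RingTheory.Localization.FractionRing
import Mathlib.RingTheory.Localization.Submodule
import HarnessLib

/-!
# The Frobenius norm ideal `[[F^e_* A]]` of a domain of characteristic `p`

Topic: `Literature/AlgebraicGeometry/Resolution`. Commutative-algebra layer of the definition of
Yasuda's **F-blowups** (`FBlowup.lean`): the *norm* (Villamayor 2006, §2) of the `A`-module
`F^e_* A = A^{1/q}`, `q = p^e`, of a domain `A` of characteristic `p` with fraction field `K`.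

For a finitely generated module `M` of generic rank `r` over a domain `A` with quotient field `K`,
Villamayor defines the class of fractional ideals
`[[M]]_A := Im(⋀^r M → ⋀^r (M ⊗_A K) ≅ K)`, well defined up to the (non-canonical)
identification `⋀^r (M ⊗_A K) ≅ K`, i.e. up to multiplication by a unit of `K`
[Villamayoru2006, §2, p. 123]; equivalently "`[[M]]` is the ideal spanned by the determinants of
all `r × r` matrices with rows in `M / tor(M)`, viewed as `r`-tuples via the inclusion in `A^r`"
[Villamayoru2006, 3.4, p. 128]. The **blow-up of `Spec A` at the module `M`** is the blow-up of
(any representative of) `[[M]]` [Villamayoru2006, Thm. 3.3]; for `M = 𝒪_X^{1/q}` this is Yasuda's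
`e`-th F-blowup [Yasuda2012, Def. 2.2 with Prop. 2.5 / Cor. 2.6 and the paragraph after it: "`FB_e(X)`
is the universal flattening of `𝒪_X^{1/q}`"].

## Rendering (the dictionary `F^e_* K ≅ (K as a K^q-vector space)`)

The `A`-module `F^e_* A` is `A` with the twisted action `a · m = a^q m`; its localisation
`F^e_* A ⊗_A K = F^e_* K` is `K` with `c · y = c^q y`, a `K`-vector space of dimension
`r = [K : K^q]`. Relabelling scalars `c ↔ c^q` identifies `F^e_* K` with **`K` as a vector space over
its subfield `K^q = {x^q}`** (`iterateFrobeniusRange K p e`, ordinary multiplication), `F^e_* A`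
with the subset `A ⊆ K`, a `K`-basis of `F^e_* K` with a `K^q`-basis `β` of `K`, and the
`K`-coordinate of `m₁ ∧ ⋯ ∧ m_r` (`mⱼ ∈ A`) with respect to `β₁ ∧ ⋯ ∧ β_r` with **the element
`d ∈ K` such that `d^q = det_β(m₁, …, m_r) ∈ K^q`** (the `q`-th root exists and is unique). Hence:

* `frobeniusNormSet β A = {d ∈ K | ∃ m : ι → A, d^q = det_β(m)}` and
  `frobeniusNorm β A = span_A (frobeniusNormSet β A) ⊆ K` — the representative of
  `[[F^e_* A]]_A` attached to the basis `β` (an `A`-submodule of `K`; a fractional ideal as soon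
  as `A` is F-finite);
* `IsFrobeniusNormIdeal K p e I` — the ideal `I ⊆ A` **is a Frobenius norm ideal**: its image
  in `K` is `frobeniusNorm β A` for some finite `K^q`-basis `β` of `K` (all representatives of
  the class that lie in `A` arise this way: changing `β` multiplies the norm by an arbitrary
  unit of `K`, `frobeniusNormSet_basis_change`). No basis indexed by a finite type exists unless
  `[K : K^q] < ∞`, so the predicate is empty (not junk) for non-F-finite fields.

PROVED API: `mem_iterateFrobeniusRange_iff`; `span_range_algebraMap_eq_top` (`K` is spanned
over `K^q` by `A`); `exists_isUnit_det` (some `r`-tuple from `A` has invertible determinant);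
`frobeniusNorm_ne_bot`, `IsFrobeniusNormIdeal.ne_bot` (**Frobenius norm ideals are nonzero**);
`frobeniusNormSet_reindex`; `frobeniusNormSet_basis_change` / `frobeniusNorm_basis_change`
(dependence on the basis = multiplication by a unit of `K`);
`IsFrobeniusNormIdeal.exists_mul_eq_mul` (**any two Frobenius norm ideals `I, J` of `A` satisfy
`f J = g I` for nonzero `f, g ∈ A`**, Villamayor's "isomorphic fractional ideals", (2.0.1));
`isFrobeniusNormIdeal_top` (over a perfect field the unit ideal is a Frobenius norm ideal:
the F-blowup of a point is the point).

## What is NOT here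

F-finiteness and finite generation of the norm; the comparison with exterior powers / Fitting
ideals of a presentation (Villamayor Prop. 2.5); the scheme-level notion (`FBlowup.lean`).

## Sources

* O. Villamayor U., *On flattening of coherent sheaves and of projective morphisms*, J. Algebra
  295 (2006) 119–140: §2 (norm of a module, (2.0.1), Prop. 2.5, Cor. 2.6), Thm. 3.3, 3.4.
  [Villamayoru2006]
* T. Yasuda, *Universal flattening of Frobenius*, Amer. J. Math. 134 (2012) 349–378
  = arXiv:0706.2700: Def. 2.2, Prop. 2.5, Cor. 2.6. [Yasuda2012]
-/

noncomputable section

open Module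

namespace Literature.AlgebraicGeometry.Resolution

universe u v

section Field

variable (K : Type u) [Field K] (p : ℕ) [ExpChar K p] (e : ℕ)

/-- The subfield `K^q = {x^q | x ∈ K}` of `q`-th powers, `q = p^e`: the image of the `e`-th
iterate of the Frobenius endomorphism of the field `K` of exponential characteristic `p`.
[folklore] -/
def iterateFrobeniusRange : Subfield K :=
  (iterateFrobenius K p e).fieldRange

variable {K p e}

/-- Membership in `K^q`: `x ∈ K^q ↔ ∃ y, y ^ p ^ e = x`. [folklore] -/
theorem mem_iterateFrobeniusRange_iff {x : K} :
    x ∈ iterateFrobeniusRange K p e ↔ ∃ y : K, y ^ p ^ e = x := by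
  simp [iterateFrobeniusRange, RingHom.mem_fieldRange, iterateFrobenius_def]

/-- `y ^ q ∈ K^q`. [folklore] -/
theorem pow_mem_iterateFrobeniusRange (y : K) : y ^ p ^ e ∈ iterateFrobeniusRange K p e :=
  mem_iterateFrobeniusRange_iff.mpr ⟨y, rfl⟩

/-- `q`-th roots are unique in a field of exponential characteristic `p` (`q = p^e`).
[folklore] -/
theorem pow_expChar_pow_injective : Function.Injective fun y : K => y ^ p ^ e :=
  iterateFrobenius_inj K p e

end Field

section Norm

variable {K : Type u} [Field K] {p : ℕ} [ExpChar K p] {e : ℕ}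
variable {ι : Type v} [Fintype ι] [DecidableEq ι]
variable (β : Basis ι (iterateFrobeniusRange K p e) K)
variable (A : Type*) [CommRing A] [Algebra A K]

/-- The **Frobenius norm set** of `A ⊆ K` with respect to the `K^q`-basis `β` of `K`: the
elements `d ∈ K` with `d^q = det_β(m₁, …, m_r)` for some `r`-tuple `m` of elements of `A` — the
`K`-coordinates of the pure wedges `m₁ ∧ ⋯ ∧ m_r ∈ ⋀^r F^e_* A` (module docstring).
[cite: Villamayoru2006, §2 p. 123 and 3.4 p. 128] -/
def frobeniusNormSet : Set K :=
  {d : K | ∃ m : ι → A, d ^ p ^ e = ((β.det fun i => algebraMap A K (m i) :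
    iterateFrobeniusRange K p e) : K)}

/-- The **Frobenius norm** `[[F^e_* A]]_β ⊆ K` of `A` with respect to `β`: the `A`-submodule of
`K` spanned by the Frobenius norm set — the representative, attached to the basis `β`, of
Villamayor's norm `[[M]]_A = Im(⋀^r M → ⋀^r(M ⊗ K) ≅ K)` of the module `M = F^e_* A = A^{1/q}`.
[cite: Villamayoru2006, §2 p. 123 and 3.4 p. 128] -/
def frobeniusNorm : Submodule A K :=
  Submodule.span A (frobeniusNormSet β A)

variable {β A}

/-- Membership in the Frobenius norm set. [folklore] -/
theorem mem_frobeniusNormSet_iff {d : K} :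
    d ∈ frobeniusNormSet β A ↔ ∃ m : ι → A, d ^ p ^ e =
      ((β.det fun i => algebraMap A K (m i) : iterateFrobeniusRange K p e) : K) :=
  Iff.rfl

/-- The norm set lies in the norm. [folklore] -/
theorem frobeniusNormSet_subset_frobeniusNorm : frobeniusNormSet β A ⊆ frobeniusNorm β A :=
  Submodule.subset_span

variable (K p e ι A)

/-- The ideal `I ⊆ A` **is a Frobenius norm ideal** (at level `e`, with respect to the fraction
field `K` of characteristic `p`): its image in `K` is the Frobenius norm `[[F^e_* A]]_β` for some
`K^q`-basis `β` of `K` indexed by a finite type — i.e. `I` is a representative, lying in `A`, of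
Villamayor's class of fractional ideals `[[F^e_* A]]_A`, whose blow-up is the blow-up of `Spec A`
at the module `F^e_* A` = the `e`-th F-blowup of `Spec A` (Villamayor 2006, Thm. 3.3; Yasuda
2012, Def. 2.2 / Cor. 2.6). [cite: Villamayoru2006, §2 p. 123, Thm. 3.3 and 3.4] -/
def IsFrobeniusNormIdeal (K : Type u) [Field K] (p : ℕ) [ExpChar K p] (e : ℕ)
    {A : Type*} [CommRing A] [Algebra A K] (I : Ideal A) : Prop :=
  ∃ (ι : Type) (_ : Fintype ι) (_ : DecidableEq ι) (β : Basis ι (iterateFrobeniusRange K p e) K),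
    IsLocalization.coeSubmodule K I = frobeniusNorm β A

variable {K p e ι A}

/-! ### `K` is spanned over `K^q` by `A`; nonvanishing of the norm -/

/-- If `K` is the fraction field of `A` then `K` is spanned over `K^q` by (the image of) `A`:
`n / d = (d⁻¹)^q · (n d^{q-1})`. [folklore] -/
theorem span_range_algebraMap_eq_top [IsDomain A] [IsFractionRing A K] :
    Submodule.span (iterateFrobeniusRange K p e) (Set.range (algebraMap A K)) = ⊤ := by
  rw [eq_top_iff]
  rintro x -
  obtain ⟨n, d, hd, rfl⟩ := IsFractionRing.div_surjective (A := A) x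
  have hD : algebraMap A K d ≠ 0 :=
    IsFractionRing.to_map_ne_zero_of_mem_nonZeroDivisors hd
  obtain ⟨m, hm⟩ : ∃ m : ℕ, p ^ e = m + 1 :=
    ⟨p ^ e - 1, (Nat.sub_add_cancel (Nat.one_le_pow _ _ (expChar_pos K p))).symm⟩
  let c : iterateFrobeniusRange K p e :=
    ⟨((algebraMap A K d)⁻¹) ^ p ^ e, pow_mem_iterateFrobeniusRange _⟩
  have hx : algebraMap A K n / algebraMap A K d =
      c • algebraMap A K (n * d ^ m) := by
    rw [Algebra.smul_def, Subfield.algebraMap_ofSubfield]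
    change _ = ((algebraMap A K d)⁻¹) ^ p ^ e * algebraMap A K (n * d ^ m)
    rw [hm, map_mul, map_pow, pow_succ, div_eq_mul_inv]
    have h1 : ((algebraMap A K d)⁻¹) ^ m * (algebraMap A K d) ^ m = 1 := by
      rw [← mul_pow, inv_mul_cancel₀ hD, one_pow]
    calc algebraMap A K n * (algebraMap A K d)⁻¹
        = ((algebraMap A K d)⁻¹ ^ m * (algebraMap A K d) ^ m) *
            (algebraMap A K n * (algebraMap A K d)⁻¹) := by rw [h1, one_mul]
      _ = _ := by ring
  rw [hx]
  exact Submodule.smul_mem _ _ (Submodule.subset_span ⟨_, rfl⟩)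

/-- Some `r`-tuple of elements of `A` has invertible determinant with respect to `β` (a
`K^q`-basis of `K = Frac A`): otherwise the nonzero alternating form `det_β` would vanish on a
basis of `K` extracted from the spanning set `A`. [folklore] -/
theorem exists_isUnit_det [IsDomain A] [IsFractionRing A K] :
    ∃ m : ι → A, IsUnit (β.det fun i => algebraMap A K (m i)) := by
  by_contra h
  push Not at h
  obtain ⟨κ, a, -, hsp, hli⟩ :=
    exists_linearIndependent' (iterateFrobeniusRange K p e) (algebraMap A K : A → K)
  have htop : ⊤ ≤ Submodule.span (iterateFrobeniusRange K p e)
      (Set.range ((algebraMap A K : A → K) ∘ a)) := by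
    rw [hsp, span_range_algebraMap_eq_top]
  let b : Basis κ (iterateFrobeniusRange K p e) K := Basis.mk hli htop
  have hzero : (β.det : MultilinearMap (iterateFrobeniusRange K p e) (fun _ : ι => K)
      (iterateFrobeniusRange K p e)) = 0 := by
    refine Basis.ext_multilinear (fun _ => b) fun v => ?_
    have h0 : β.det (fun i => algebraMap A K (a (v i))) = 0 :=
      not_not.mp fun hne => h (fun i => a (v i)) (isUnit_iff_ne_zero.mpr hne)
    have hv : (fun i => b (v i)) = fun i => algebraMap A K (a (v i)) := by
      funext i
      simp [b]
    rw [hv]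
    exact h0
  have h1 : β.det β = 0 := DFunLike.congr_fun hzero (β : ι → K)
  rw [β.det_self] at h1
  exact one_ne_zero h1

/-- **The Frobenius norm is nonzero** (for `K` the fraction field of `A`): it contains a `q`-th
root of an invertible determinant. [folklore] -/
theorem frobeniusNorm_ne_bot [IsDomain A] [IsFractionRing A K] : frobeniusNorm β A ≠ ⊥ := by
  obtain ⟨m, hm⟩ := exists_isUnit_det (β := β) (A := A)
  obtain ⟨d, hd⟩ := mem_iterateFrobeniusRange_iff.mp (β.det fun i => algebraMap A K (m i)).2
  have hd0 : d ≠ 0 := by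
    rintro rfl
    rw [zero_pow (pow_ne_zero _ (expChar_pos K p).ne')] at hd
    exact hm.ne_zero (Subtype.ext hd.symm)
  intro h
  have : d ∈ frobeniusNorm β A := frobeniusNormSet_subset_frobeniusNorm ⟨m, hd⟩
  rw [h, Submodule.mem_bot] at this
  exact hd0 this

/-- **Frobenius norm ideals are nonzero.** [folklore] -/
theorem IsFrobeniusNormIdeal.ne_bot [IsDomain A] [IsFractionRing A K] {I : Ideal A}
    (hI : IsFrobeniusNormIdeal K p e I) : I ≠ ⊥ := by
  obtain ⟨ι, _, _, β, hβ⟩ := hI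
  rintro rfl
  exact frobeniusNorm_ne_bot (β := β) (A := A) (hβ ▸ IsLocalization.coeSubmodule_bot K)

/-! ### Dependence on the basis -/

/-- Reindexing the basis does not change the Frobenius norm set. [folklore] -/
theorem frobeniusNormSet_reindex {ι' : Type*} [Fintype ι'] [DecidableEq ι'] (f : ι ≃ ι') :
    frobeniusNormSet (β.reindex f) A = frobeniusNormSet β A := by
  ext d
  simp only [mem_frobeniusNormSet_iff, Basis.det_reindex]
  constructor
  · rintro ⟨m, hm⟩
    exact ⟨m ∘ f, hm⟩
  · rintro ⟨m, hm⟩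
    refine ⟨m ∘ f.symm, ?_⟩
    rw [hm]
    congr 2
    funext i
    simp

/-- Reindexing the basis does not change the Frobenius norm. [folklore] -/
theorem frobeniusNorm_reindex {ι' : Type*} [Fintype ι'] [DecidableEq ι'] (f : ι ≃ ι') :
    frobeniusNorm (β.reindex f) A = frobeniusNorm β A := by
  rw [frobeniusNorm, frobeniusNormSet_reindex, frobeniusNorm]

/-- **Change of basis multiplies the Frobenius norm set by a unit of `K`**: if `v^q = det_{β'}(β)`
then the norm set for `β'` is `v` times the norm set for `β` (`det_{β'} = det_{β'}(β) · det_β`).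
This is Villamayor's "the identification `⋀^r M ⊗ K ≅ K` is not canonical, so the image is
well-defined up to isomorphism". [cite: Villamayoru2006, §2 p. 123] -/
theorem frobeniusNormSet_basis_change (β' : Basis ι (iterateFrobeniusRange K p e) K) {v : K}
    (hv : v ^ p ^ e = ((β'.det β : iterateFrobeniusRange K p e) : K)) :
    frobeniusNormSet β' A = (v * ·) '' frobeniusNormSet β A := by
  have hv0 : v ≠ 0 := by
    rintro rfl
    rw [zero_pow (pow_ne_zero _ (expChar_pos K p).ne')] at hv
    exact (β'.isUnit_det β).ne_zero (Subtype.ext hv.symm)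
  have key : ∀ w : ι → K, ((β'.det w : iterateFrobeniusRange K p e) : K) =
      v ^ p ^ e * ((β.det w : iterateFrobeniusRange K p e) : K) := by
    intro w
    rw [AlternatingMap.eq_smul_basis_det β β'.det, AlternatingMap.smul_apply, smul_eq_mul,
      Subfield.coe_mul, hv]
  ext d
  simp only [mem_frobeniusNormSet_iff, Set.mem_image]
  constructor
  · rintro ⟨m, hm⟩
    refine ⟨d / v, ⟨m, ?_⟩, mul_div_cancel₀ d hv0⟩
    rw [div_pow, hm, key, mul_div_cancel_left₀ _ (pow_ne_zero _ hv0)]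
  · rintro ⟨d₀, ⟨m, hm⟩, rfl⟩
    exact ⟨m, by rw [mul_pow, hm, key]⟩

/-- **Change of basis multiplies the Frobenius norm by a unit of `K`.**
[cite: Villamayoru2006, §2 p. 123] -/
theorem frobeniusNorm_basis_change (β' : Basis ι (iterateFrobeniusRange K p e) K) {v : K}
    (hv : v ^ p ^ e = ((β'.det β : iterateFrobeniusRange K p e) : K)) :
    frobeniusNorm β' A = (frobeniusNorm β A).map (LinearMap.mulLeft A v) := by
  rw [frobeniusNorm, frobeniusNorm, Submodule.map_span, frobeniusNormSet_basis_change β' hv]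
  rfl

/-- **Any two Frobenius norm ideals of `A` are isomorphic fractional ideals**: `f • J = g • I`
for some nonzero `f, g ∈ A` (Villamayor (2.0.1): fractional ideals are isomorphic iff they
differ by a unit of `K`). Consequently they have the same blow-up. [cite: Villamayoru2006, (2.0.1)
p. 122–123] -/
theorem IsFrobeniusNormIdeal.exists_mul_eq_mul [IsDomain A] [IsFractionRing A K] {I J : Ideal A}
    (hI : IsFrobeniusNormIdeal K p e I) (hJ : IsFrobeniusNormIdeal K p e J) :
    ∃ f g : A, f ≠ 0 ∧ g ≠ 0 ∧ Ideal.span {f} * J = Ideal.span {g} * I := by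
  obtain ⟨ι, _, _, β, hβ⟩ := hI
  obtain ⟨ι', _, _, β', hβ'⟩ := hJ
  -- reindex `β'` by `ι`
  haveI : Module.Finite (iterateFrobeniusRange K p e) K := Module.Finite.of_basis β
  have hcard : Fintype.card ι' = Fintype.card ι := by
    rw [← Module.finrank_eq_card_basis β, ← Module.finrank_eq_card_basis β']
  let f : ι' ≃ ι := Fintype.equivOfCardEq hcard
  let β'' : Basis ι (iterateFrobeniusRange K p e) K := β'.reindex f
  have hβ'' : IsLocalization.coeSubmodule K J = frobeniusNorm β'' A := by
    rw [hβ', frobeniusNorm_reindex]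
  -- the unit `v` with `[[A]]_{β''} = v [[A]]_β`, written as `g / f`
  obtain ⟨v, hv⟩ := mem_iterateFrobeniusRange_iff.mp (β''.det β).2
  have hv0 : v ≠ 0 := by
    rintro rfl
    rw [zero_pow (pow_ne_zero _ (expChar_pos K p).ne')] at hv
    exact (β''.isUnit_det β).ne_zero (Subtype.ext hv.symm)
  obtain ⟨g, f, hf, hgf⟩ := IsFractionRing.div_surjective (A := A) v
  have hf0 : f ≠ 0 := nonZeroDivisors.ne_zero hf
  have hF : algebraMap A K f ≠ 0 := IsFractionRing.to_map_ne_zero_of_mem_nonZeroDivisors hf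
  have hg0 : g ≠ 0 := by
    rintro rfl
    rw [map_zero, zero_div] at hgf
    exact hv0 hgf.symm
  refine ⟨f, g, hf0, hg0, ?_⟩
  apply IsFractionRing.coeSubmodule_injective A K
  rw [IsLocalization.coeSubmodule_mul, IsLocalization.coeSubmodule_mul,
    IsLocalization.coeSubmodule_span_singleton, IsLocalization.coeSubmodule_span_singleton,
    hβ, hβ'', frobeniusNorm_basis_change β'' hv]
  -- `(f) · v • N = (g) · N` as submodules of `K`, where `v = g / f`
  apply le_antisymm
  · rw [Submodule.mul_le]
    rintro x hx _ ⟨y, hy, rfl⟩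
    obtain ⟨a, rfl⟩ := Submodule.mem_span_singleton.mp hx
    change a • algebraMap A K f * (v * y) ∈ _
    have : a • algebraMap A K f * (v * y) = algebraMap A K g * (a • y) := by
      rw [← hgf, Algebra.smul_def, Algebra.smul_def]
      field_simp
    rw [this]
    exact Submodule.mul_mem_mul (Submodule.mem_span_singleton_self _)
      (Submodule.smul_mem _ _ hy)
  · rw [Submodule.mul_le]
    rintro x hx y hy
    obtain ⟨a, rfl⟩ := Submodule.mem_span_singleton.mp hx
    have : a • algebraMap A K g * y = algebraMap A K f * (v * (a • y)) := by
      rw [← hgf, Algebra.smul_def, Algebra.smul_def]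
      field_simp
    rw [this]
    exact Submodule.mul_mem_mul (Submodule.mem_span_singleton_self _)
      ⟨a • y, Submodule.smul_mem _ _ hy, rfl⟩

/-! ### Non-vacuity: the point -/

/-- Over a **perfect** field `k` (so `k^q = k`) the unit ideal of `k` is a Frobenius norm ideal:
`det_β(β) = 1 = 1^q`. (The F-blowup of `Spec k` is `Spec k`.) [folklore] -/
theorem isFrobeniusNormIdeal_top (k : Type u) [Field k] (p : ℕ) [ExpChar k p] [PerfectRing k p]
    (e : ℕ) : IsFrobeniusNormIdeal k p e (⊤ : Ideal k) := by
  classical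
  -- `k` is finite (one-)dimensional over `k^q = k`
  have htop : iterateFrobeniusRange k p e = ⊤ := by
    ext x
    simp only [mem_iterateFrobeniusRange_iff, Subfield.mem_top, iff_true]
    exact (bijective_iterateFrobenius k p e).2 x
  haveI : Module.Finite (iterateFrobeniusRange k p e) k := by
    refine Module.finite_def.mpr ⟨{1}, ?_⟩
    rw [eq_top_iff]
    rintro x -
    have hx : x = (⟨x, htop ▸ Subfield.mem_top x⟩ : iterateFrobeniusRange k p e) • (1 : k) := by
      rw [Algebra.smul_def, Subfield.algebraMap_ofSubfield, mul_one]
      rfl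
    rw [Finset.coe_singleton, hx]
    exact Submodule.smul_mem _ _ (Submodule.subset_span rfl)
  let β := Module.finBasis (iterateFrobeniusRange k p e) k
  refine ⟨_, inferInstance, inferInstance, β, ?_⟩
  rw [IsLocalization.coeSubmodule_top]
  symm
  rw [frobeniusNorm, Submodule.one_eq_span, Submodule.span_eq_span]
  · intro d _
    exact Submodule.mem_span_singleton.mpr ⟨d, by simp⟩
  · rintro _ rfl
    refine Submodule.subset_span ⟨fun i => β i, ?_⟩
    simp [β.det_self]

end Norm

end Literature.AlgebraicGeometry.Resolution

end
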